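import Summits.Ventures.HSemireg.WedgeHankelSubstitutionFrameEigen
import Summits.Ventures.HSemireg.WedgeHankelSubstitutionClassSpace

/-!
# Venture HSemireg — A SUBSTITUTION WITH TWO DISTINCT FIXED NODES IS DIAGONALIZABLE ON TH-7's CLASS SPACE, BASIS-FREE: an EIGENBASIS of `spikeSpan n` for `SbC(g)` with the weights
# `(α+λ₁γ)^{n−p}(α+λ₂γ)^p`, the eigenspaces exhaust the class space, `Π_p (SbC(g) − μ_p) = 0`, and when the weights are pairwise distinct `minpoly(SbC(g)) = charpoly = Π_p (X − μ_p)`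

HONEST FRAMING. Part of the Lean index of the computation cell `pub-hsemireg` (seat p10 gen 20, Sunday typer «UNIFORM-IN-n»).
Finite-dimensional EXTERIOR ALGEBRA + linear algebra ONLY: no variety, no cohomology theory, no sheaf, no Ext group, no semiregularity map;
nothing here says that HC / HC_CM / HC_AV holds; no Literature fact is declared or used.  Custodian versions as in `WedgeHankelSiegelIdeal` (1/3) and `WedgeHankelFrameChange`;
the dictionary (a semisimple `g ∈ GL₂` with `K`-rational eigenvalues `μ, ν` acts on `Sym^n` with the weights `μ^{n−p}ν^p`) is QUOTED, never asserted.

WHAT IS IN THE TREE.  I6 (`WedgeHankelSubstitutionFrameEigen`): the frame classes `F_p = Sb 1 λ₁ 1 λ₂ (E_p)` are eigenvectors of every substitution fixing `λ₁ ≠ λ₂`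
(`Sb_frame_spike_eigen_top`), linearly independent (`linearIndependent_frame_spike`) and spanning `coSiegel_n` (`span_frame_spike_eq_coSiegel`) — all on the exterior algebra;
I11 (`WedgeHankelSubstitutionClassSpace`): `spikeSpan` (`= coSiegel_n`), `SbC`, `charpoly_SbC_of_fixed_two` (`Π_p (X − C μ_p)`).  THIS FILE (namespace
`Summit.Ventures.HSemireg.Wedge.HankelFrameChange` continued; imports I6, I11) packages this BASIS-FREE on the class space:
* §262 `frame_spike_mem_spikeSpan`, `linearIndependent_frame_spike_spikeSpan`, `span_frame_spike_spikeSpan_eq_top`, **`exists_eigenbasis_SbC_of_fixed_two`** (an eigenBASIS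
  `b : Basis (Fin (n+1)) K (spikeSpan n)` with `SbC(g) (b p) = μ_p • b p`, `μ_p = (α+λ₁γ)^{n−p}(α+λ₂γ)^p`), **`iSup_eigenspace_SbC_eq_top_of_fixed_two`** (the eigenspaces exhaust the
  class space), `hasEigenvalue_SbC_weight_of_fixed_two`.
* §263 **`prod_SbC_sub_weight_eq_zero_of_fixed_two`** (`Π_p (SbC(g) − μ_p) = 0`), `minpoly_SbC_dvd_prod_of_fixed_two` (`minpoly ∣ Π_p (X − C μ_p)`), and for pairwise DISTINCT
  weights **`minpoly_SbC_of_fixed_two_of_injective`: `minpoly(SbC(g)) = Π_p (X − C μ_p) = charpoly`** (multiplicity-free spectrum).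
NOT typed here: when the weights coincide (`(α+λ₁γ)/(α+λ₂γ)` a root of unity of order `≤ n`): `minpoly = Π` over the DISTINCT weights; the `∞` companion (one node at `∞`, I6's
`_infty` family) — same proofs; anything Ext-side.  New names only.
-/

open Module

namespace Summit.Ventures.HSemireg.Wedge.HankelFrameChange

open Summit.Ventures.HSemireg.Wedge Summit.Ventures.HSemireg.Wedge.Kunneth Summit.Ventures.HSemireg.Wedge.Hankel
  Summit.Ventures.HSemireg.Wedge.BasisFree Summit.Ventures.HSemireg.Wedge.HankelSiegel Summit.Ventures.HSemireg.Wedge.HankelSiegelIdeal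
  Summit.Ventures.HSemireg.Wedge.KunnethKernel Summit.Ventures.HSemireg.Wedge.HankelRankOne Summit.Ventures.HSemireg.Wedge.KernelDuality

variable (K : Type*) [Field K] {n : ℕ}

/-! ## §262. The frame classes as an eigenbasis of the class space -/

/-- the frame classes lie in the class space. -/
theorem frame_spike_mem_spikeSpan (l₁ l₂ : K) (p : Fin (n + 1)) :
    Sb K 1 l₁ 1 l₂ (w K n n (fun j => if j = (p : ℕ) then (1 : K) else 0)) ∈ spikeSpan K n := by
  rw [spikeSpan_eq_coSiegel]; exact Sb_w_mem_coSiegel K 1 l₁ 1 l₂ _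

/-- they are linearly independent in the class space (I6, pulled back along the inclusion). -/
theorem linearIndependent_frame_spike_spikeSpan {l₁ l₂ : K} (h₁₂ : l₁ ≠ l₂) :
    LinearIndependent K (fun p : Fin (n + 1) => (⟨Sb K 1 l₁ 1 l₂ (w K n n (fun j => if j = (p : ℕ) then (1 : K) else 0)), frame_spike_mem_spikeSpan K l₁ l₂ p⟩ : spikeSpan K n)) := by
  apply LinearIndependent.of_comp (spikeSpan K n).subtype
  exact linearIndependent_frame_spike K h₁₂

/-- they span the class space (I6 `span_frame_spike_eq_coSiegel`). -/
theorem span_frame_spike_spikeSpan_eq_top {l₁ l₂ : K} (h₁₂ : l₁ ≠ l₂) :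
    Submodule.span K (Set.range fun p : Fin (n + 1) =>
      (⟨Sb K 1 l₁ 1 l₂ (w K n n (fun j => if j = (p : ℕ) then (1 : K) else 0)), frame_spike_mem_spikeSpan K l₁ l₂ p⟩ : spikeSpan K n)) = ⊤ := by
  apply Submodule.map_injective_of_injective (spikeSpan K n).injective_subtype
  rw [Submodule.map_subtype_top, Submodule.map_span, ← Set.range_comp]
  have e : ((spikeSpan K n).subtype ∘ fun p : Fin (n + 1) =>
      (⟨Sb K 1 l₁ 1 l₂ (w K n n (fun j => if j = (p : ℕ) then (1 : K) else 0)), frame_spike_mem_spikeSpan K l₁ l₂ p⟩ : spikeSpan K n)) =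
      fun p : Fin (n + 1) => Sb K 1 l₁ 1 l₂ (w K n n (fun j => if j = (p : ℕ) then (1 : K) else 0)) := rfl
  rw [e, span_frame_spike_eq_coSiegel K h₁₂, spikeSpan_eq_coSiegel]

/-- **AN EIGENBASIS OF THE CLASS SPACE for every substitution with two distinct fixed nodes `λ₁ ≠ λ₂` in `K`** (`β + λ_iδ = λ_i(α + λ_iγ)`): `b p = Sb 1 λ₁ 1 λ₂ (E_p)` with
`SbC(g)(b p) = (α+λ₁γ)^{n−p}(α+λ₂γ)^p • b p`. -/
theorem exists_eigenbasis_SbC_of_fixed_two {α β γ δ l₁ l₂ : K} (h₁₂ : l₁ ≠ l₂) (e₁ : β + l₁ * δ = l₁ * (α + l₁ * γ)) (e₂ : β + l₂ * δ = l₂ * (α + l₂ * γ)) :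
    ∃ b : Basis (Fin (n + 1)) K (spikeSpan K n), ∀ p : Fin (n + 1), SbC K α β γ δ (b p) = ((α + l₁ * γ) ^ (n - (p : ℕ)) * (α + l₂ * γ) ^ (p : ℕ)) • b p := by
  refine ⟨Basis.mk (linearIndependent_frame_spike_spikeSpan K h₁₂) (span_frame_spike_spikeSpan_eq_top K h₁₂).ge, fun p => ?_⟩
  rw [Basis.mk_apply]
  exact Subtype.ext (by rw [SbC_apply_coe, Submodule.coe_smul]; exact Sb_frame_spike_eigen_top K e₁ e₂ p)

/-- each weight `(α+λ₁γ)^{n−p}(α+λ₂γ)^p` IS an eigenvalue on the class space. -/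
theorem hasEigenvalue_SbC_weight_of_fixed_two {α β γ δ l₁ l₂ : K} (h₁₂ : l₁ ≠ l₂) (e₁ : β + l₁ * δ = l₁ * (α + l₁ * γ)) (e₂ : β + l₂ * δ = l₂ * (α + l₂ * γ))
    (p : Fin (n + 1)) : Module.End.HasEigenvalue (SbC K α β γ δ (n := n)) ((α + l₁ * γ) ^ (n - (p : ℕ)) * (α + l₂ * γ) ^ (p : ℕ)) := by
  obtain ⟨b, hb⟩ := exists_eigenbasis_SbC_of_fixed_two K (n := n) h₁₂ e₁ e₂
  exact Module.End.hasEigenvalue_of_hasEigenvector (Module.End.hasEigenvector_iff.mpr ⟨Module.End.mem_eigenspace_iff.mpr (hb p), b.ne_zero p⟩)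

/-- **THE EIGENSPACES EXHAUST THE CLASS SPACE: `⨆_μ eigenspace(SbC(g), μ) = ⊤`** (two distinct fixed nodes). -/
theorem iSup_eigenspace_SbC_eq_top_of_fixed_two {α β γ δ l₁ l₂ : K} (h₁₂ : l₁ ≠ l₂) (e₁ : β + l₁ * δ = l₁ * (α + l₁ * γ)) (e₂ : β + l₂ * δ = l₂ * (α + l₂ * γ)) :
    ⨆ μ : K, Module.End.eigenspace (SbC K α β γ δ (n := n)) μ = ⊤ := by
  obtain ⟨b, hb⟩ := exists_eigenbasis_SbC_of_fixed_two K (n := n) h₁₂ e₁ e₂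
  rw [eq_top_iff, ← b.span_eq, Submodule.span_le]
  rintro _ ⟨p, rfl⟩
  exact Submodule.mem_iSup_of_mem _ (Module.End.mem_eigenspace_iff.mpr (hb p))

/-! ## §263. The annihilating product and the minimal polynomial for distinct weights -/

/-- **`Π_p (SbC(g) − μ_p) = 0` on the class space** (`μ_p = (α+λ₁γ)^{n−p}(α+λ₂γ)^p`; the product annihilates every vector of the eigenbasis). -/
theorem prod_SbC_sub_weight_eq_zero_of_fixed_two {α β γ δ l₁ l₂ : K} (h₁₂ : l₁ ≠ l₂) (e₁ : β + l₁ * δ = l₁ * (α + l₁ * γ)) (e₂ : β + l₂ * δ = l₂ * (α + l₂ * γ)) :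
    Polynomial.aeval (SbC K α β γ δ (n := n)) (∏ p : Fin (n + 1), (Polynomial.X - Polynomial.C ((α + l₁ * γ) ^ (n - (p : ℕ)) * (α + l₂ * γ) ^ (p : ℕ)))) = 0 := by
  rw [← charpoly_SbC_of_fixed_two K h₁₂ e₁ e₂]
  exact LinearMap.aeval_self_charpoly _

/-- `minpoly(SbC(g)) ∣ Π_p (X − C μ_p)` (two distinct fixed nodes). -/
theorem minpoly_SbC_dvd_prod_of_fixed_two {α β γ δ l₁ l₂ : K} (h₁₂ : l₁ ≠ l₂) (e₁ : β + l₁ * δ = l₁ * (α + l₁ * γ)) (e₂ : β + l₂ * δ = l₂ * (α + l₂ * γ)) :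
    minpoly K (SbC K α β γ δ (n := n)) ∣ ∏ p : Fin (n + 1), (Polynomial.X - Polynomial.C ((α + l₁ * γ) ^ (n - (p : ℕ)) * (α + l₂ * γ) ^ (p : ℕ))) :=
  minpoly.dvd K _ (prod_SbC_sub_weight_eq_zero_of_fixed_two K h₁₂ e₁ e₂)

/-- **MULTIPLICITY-FREE SPECTRUM: if the weights `μ_p = (α+λ₁γ)^{n−p}(α+λ₂γ)^p` are pairwise distinct then `minpoly(SbC(g)) = Π_p (X − C μ_p)` (`= charpoly`)** — each `X − C μ_p`
divides the minimal polynomial (every `μ_p` is an eigenvalue), the factors are pairwise coprime, and both sides are monic. -/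
theorem minpoly_SbC_of_fixed_two_of_injective {α β γ δ l₁ l₂ : K} (h₁₂ : l₁ ≠ l₂) (e₁ : β + l₁ * δ = l₁ * (α + l₁ * γ)) (e₂ : β + l₂ * δ = l₂ * (α + l₂ * γ))
    (hμ : Function.Injective fun p : Fin (n + 1) => (α + l₁ * γ) ^ (n - (p : ℕ)) * (α + l₂ * γ) ^ (p : ℕ)) :
    minpoly K (SbC K α β γ δ (n := n)) = ∏ p : Fin (n + 1), (Polynomial.X - Polynomial.C ((α + l₁ * γ) ^ (n - (p : ℕ)) * (α + l₂ * γ) ^ (p : ℕ))) := by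
  have hT : IsIntegral K (SbC K α β γ δ (n := n)) := Algebra.IsIntegral.isIntegral _
  have h1 := minpoly_SbC_dvd_prod_of_fixed_two K (n := n) h₁₂ e₁ e₂
  have h2 : (∏ p : Fin (n + 1), (Polynomial.X - Polynomial.C ((α + l₁ * γ) ^ (n - (p : ℕ)) * (α + l₂ * γ) ^ (p : ℕ)))) ∣ minpoly K (SbC K α β γ δ (n := n)) := by
    refine Finset.prod_dvd_of_coprime (fun p _ p' _ hpp' => Polynomial.pairwise_coprime_X_sub_C hμ hpp') fun p _ => ?_
    exact Polynomial.dvd_iff_isRoot.mpr (Module.End.isRoot_of_hasEigenvalue (hasEigenvalue_SbC_weight_of_fixed_two K h₁₂ e₁ e₂ p))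
  exact Polynomial.eq_of_monic_of_associated (minpoly.monic hT) (Polynomial.monic_prod_of_monic _ _ fun p _ => Polynomial.monic_X_sub_C _) (associated_of_dvd_dvd h1 h2)

/-- then `minpoly = charpoly` (I11). -/
theorem minpoly_SbC_eq_charpoly_of_fixed_two_of_injective {α β γ δ l₁ l₂ : K} (h₁₂ : l₁ ≠ l₂) (e₁ : β + l₁ * δ = l₁ * (α + l₁ * γ)) (e₂ : β + l₂ * δ = l₂ * (α + l₂ * γ))
    (hμ : Function.Injective fun p : Fin (n + 1) => (α + l₁ * γ) ^ (n - (p : ℕ)) * (α + l₂ * γ) ^ (p : ℕ)) :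
    minpoly K (SbC K α β γ δ (n := n)) = (SbC K α β γ δ (n := n)).charpoly := by
  rw [minpoly_SbC_of_fixed_two_of_injective K h₁₂ e₁ e₂ hμ, charpoly_SbC_of_fixed_two K h₁₂ e₁ e₂]

end Summit.Ventures.HSemireg.Wedge.HankelFrameChange
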